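import Mathlib
import HarnessLib
import Summits.HubbardSuperconductivity.HubbardSuperconductivity.Theorems.KLProgrammeSWaveCascadeSignedAlgebra

/-!
# Route `KLProgramme` — the repulsive scalar cascade with a NEGATIVE-MASS FLOOR, and implicit-step uniqueness from positivity of `1 + U·W`
# (row 0′ of child 1 under the Δ21 text of record: signed weights, NO net-mass floor beyond the edge allowance)

Cell gate-hubbard-kl, seat hubbard-kl-k3c1-p2.  The Δ21 clause of record (p1 g7, cell STATUS 2026-08-26T21:52:53Z: `PairLadderStepAtV8`) types
`Σ_p |w p| ≤ bhi` and `Σ_p (|w p| − w p) ≤ 2·klEdge G n |Qm|_𝕋` and NO sign for the net mass `W_n = Σ_p w p`; hence `W_n ≥ −ν_n` only, with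
`ν_n := Σ(|w| − w)` scale-summable per pair momentum.  The scalar s-wave cascade `U_{n+1} = U_n/(1 + W_n U_n)` is then no longer monotone; here
is its control from `16·U_0·Σ_{j<N} ν_j ≤ 1`: `0 ≤ U_n`, `U_n·(1 − U_0 Σ_{j<n} ν_j) ≤ U_0` (so `U_n ≤ (16/15)·U_0`), `0 < 1 + W_n U_n`,
`U_{n+1}(1 + W_n U_n) = U_n`, `W_n U_{n+1} ≤ 1` (`sWaveFloor_*`), and the implicit-step uniqueness lemma under `0 < 1 + U·Σw`
(`eq_zero_of_add_smul_wmul_onesArr_of_pos`).  Everything is proved; no definitions.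
-/

noncomputable section

namespace Summit.HubbardSuperconductivity.HubbardSuperconductivity.Theorems.SWaveCascade

set_option linter.dupNamespace false -- summit = problem name (single-conjunct summit), D-0017

open Finset

variable {S : Type*} [Fintype S]

/-- Uniqueness for the implicit step from `0 < 1 + U·Σw` alone: `Z + U·(Z ∗_w J) = 0` forces `Z = 0`. -/
theorem eq_zero_of_add_smul_wmul_onesArr_of_pos {w : S → ℝ} {U : ℝ} (hUW : 0 < 1 + U * ∑ u, w u)
    {Z : S → S → ℂ} (h : Z + (U : ℂ) • wmul w Z onesArr = 0) : Z = 0 := by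
  have hrow : ∀ s, ∑ u, Z s u * (w u : ℂ) = 0 := by
    intro s
    have hs : ∀ t, Z s t + (U : ℂ) * ∑ u, Z s u * (w u : ℂ) = 0 := fun t => by
      have := congrFun (congrFun h s) t
      simpa [wmul, onesArr] using this
    set A : ℂ := ∑ u, Z s u * (w u : ℂ) with hA_def
    have hZ : ∀ t, Z s t = -((U : ℂ) * A) := fun t => eq_neg_of_add_eq_zero_left (hs t)
    have hA : A = -((U : ℂ) * A) * ∑ t, (w t : ℂ) := by
      calc A = ∑ t, Z s t * (w t : ℂ) := rfl
        _ = ∑ t, -((U : ℂ) * A) * (w t : ℂ) := sum_congr rfl fun t _ => by rw [hZ t]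
        _ = -((U : ℂ) * A) * ∑ t, (w t : ℂ) := (mul_sum _ _ _).symm
    have hsum : A * (1 + (U : ℂ) * ∑ t, (w t : ℂ)) = 0 := by linear_combination hA
    have hne : (1 + (U : ℂ) * ∑ t, (w t : ℂ)) ≠ 0 := by
      have : (1 + (U : ℂ) * ∑ t, (w t : ℂ)) = (((1 + U * ∑ t, w t : ℝ)) : ℂ) := by push_cast; ring
      rw [this]; exact_mod_cast hUW.ne'
    exact (mul_eq_zero.1 hsum).resolve_right hne
  funext s t
  have := congrFun (congrFun h s) t
  simp only [Pi.add_apply, Pi.smul_apply, smul_eq_mul, Pi.zero_apply, wmul, onesArr, mul_one] at this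
  rw [hrow s, mul_zero, add_zero] at this
  exact this

section Scalar

variable {U W ν : ℕ → ℝ} {N : ℕ}

/-- **The scalar cascade with a negative-mass floor.**  `U_0 ≥ 0`, `U_{n+1} = U_n/(1 + W_n U_n)`, `W_n ≥ −ν_n`, `ν_n ≥ 0`,
`16·U_0·Σ_{j<N} ν_j ≤ 1` ⟹ for every `n ≤ N`: `0 ≤ U_n` and `U_n·(1 − U_0·Σ_{j<n} ν_j) ≤ U_0`. -/
theorem sWaveFloor_aux (h0 : 0 ≤ U 0) (hU : ∀ n, U (n + 1) = U n / (1 + W n * U n)) (hWν : ∀ n, -ν n ≤ W n)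
    (hν0 : ∀ n, 0 ≤ ν n) (hsmall : 16 * U 0 * ∑ j ∈ range N, ν j ≤ 1) :
    ∀ n ≤ N, 0 ≤ U n ∧ U n * (1 - U 0 * ∑ j ∈ range n, ν j) ≤ U 0 := by
  have hs_le : ∀ n ≤ N, U 0 * ∑ j ∈ range n, ν j ≤ 1 / 16 := fun n hn => by
    have h1 : ∑ j ∈ range n, ν j ≤ ∑ j ∈ range N, ν j := sum_le_sum_of_subset_of_nonneg (range_mono hn) fun j _ _ => hν0 j
    have h2 := mul_le_mul_of_nonneg_left h1 h0
    linarith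
  intro n
  induction n with
  | zero => intro _; exact ⟨h0, by simp⟩
  | succ n ih =>
    intro hn
    obtain ⟨hUn, hb⟩ := ih (Nat.le_of_succ_le hn)
    have hsn := hs_le n (Nat.le_of_succ_le hn)
    have hsn1 := hs_le (n + 1) hn
    rw [sum_range_succ, mul_add] at hsn1 ⊢
    have hy0 : 0 ≤ U 0 * ∑ j ∈ range n, ν j := mul_nonneg h0 (sum_nonneg fun j _ => hν0 j)
    -- `U_n ≤ (16/15) U_0`, so `ν_n U_n ≤ 1/15`
    have hUnle : U n * (15 / 16) ≤ U 0 := by nlinarith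
    have hνU : ν n * U n ≤ 1 / 15 := by nlinarith [hν0 n, mul_nonneg h0 (hν0 n)]
    have hden : 0 < 1 + W n * U n := by nlinarith [hWν n, hν0 n]
    have hden' : 0 < 1 - ν n * U n := by linarith
    refine ⟨by rw [hU n]; exact div_nonneg hUn hden.le, ?_⟩
    -- `U_{n+1} ≤ U_n/(1 − ν_n U_n)` and `U_n (1 − s_n − U_0 ν_n) ≤ U_0 (1 − ν_n U_n)`
    have h1 : U (n + 1) ≤ U n / (1 - ν n * U n) := by
      rw [hU n]; exact div_le_div_of_nonneg_left hUn hden' (by nlinarith [hWν n])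
    have h2 : U n * (1 - (U 0 * ∑ j ∈ range n, ν j + U 0 * ν n)) ≤ U 0 * (1 - ν n * U n) := by nlinarith
    have h3 : 0 ≤ 1 - (U 0 * ∑ j ∈ range n, ν j + U 0 * ν n) := by linarith
    calc U (n + 1) * (1 - (U 0 * ∑ j ∈ range n, ν j + U 0 * ν n))
        ≤ U n / (1 - ν n * U n) * (1 - (U 0 * ∑ j ∈ range n, ν j + U 0 * ν n)) := mul_le_mul_of_nonneg_right h1 h3
      _ = U n * (1 - (U 0 * ∑ j ∈ range n, ν j + U 0 * ν n)) / (1 - ν n * U n) := by ring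
      _ ≤ U 0 * (1 - ν n * U n) / (1 - ν n * U n) := div_le_div_of_nonneg_right h2 hden'.le
      _ = U 0 := by field_simp

/-- The consequences used by the cascade: for `n ≤ N`, `0 ≤ U_n ≤ (16/15)·U_0`. -/
theorem sWaveFloor_bounds (h0 : 0 ≤ U 0) (hU : ∀ n, U (n + 1) = U n / (1 + W n * U n)) (hWν : ∀ n, -ν n ≤ W n)
    (hν0 : ∀ n, 0 ≤ ν n) (hsmall : 16 * U 0 * ∑ j ∈ range N, ν j ≤ 1) :
    ∀ n ≤ N, 0 ≤ U n ∧ U n ≤ 16 / 15 * U 0 := by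
  intro n hn
  obtain ⟨hUn, hb⟩ := sWaveFloor_aux h0 hU hWν hν0 hsmall n hn
  have h1 : ∑ j ∈ range n, ν j ≤ ∑ j ∈ range N, ν j := sum_le_sum_of_subset_of_nonneg (range_mono hn) fun j _ _ => hν0 j
  have h2 := mul_le_mul_of_nonneg_left h1 h0
  exact ⟨hUn, by nlinarith⟩

/-- … and for `n < N`: `0 < 1 + W_n U_n`, the relation `U_{n+1}(1 + W_n U_n) = U_n`, `W_n U_{n+1} ≤ 1`, and `ν_n U_n ≤ 1/15`. -/
theorem sWaveFloor_step (h0 : 0 ≤ U 0) (hU : ∀ n, U (n + 1) = U n / (1 + W n * U n)) (hWν : ∀ n, -ν n ≤ W n)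
    (hν0 : ∀ n, 0 ≤ ν n) (hsmall : 16 * U 0 * ∑ j ∈ range N, ν j ≤ 1) :
    ∀ n < N, 0 < 1 + W n * U n ∧ U (n + 1) * (1 + W n * U n) = U n ∧ W n * U (n + 1) ≤ 1 ∧ ν n * U n ≤ 1 / 15 := by
  intro n hn
  obtain ⟨hUn, hUle⟩ := sWaveFloor_bounds h0 hU hWν hν0 hsmall n hn.le
  have hνn : U 0 * ν n ≤ 1 / 16 := by
    have h1 : ν n ≤ ∑ j ∈ range N, ν j := single_le_sum (f := ν) (fun j _ => hν0 j) (mem_range.2 hn)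
    have h2 := mul_le_mul_of_nonneg_left h1 h0
    linarith
  have hνU : ν n * U n ≤ 1 / 15 := by nlinarith [hν0 n, mul_nonneg h0 (hν0 n)]
  have hden : 0 < 1 + W n * U n := by nlinarith [hWν n, hν0 n]
  refine ⟨hden, by rw [hU n, div_mul_cancel₀ _ hden.ne'], ?_, hνU⟩
  rw [hU n, ← mul_div_assoc, div_le_one hden]
  linarith

end Scalar

end Summit.HubbardSuperconductivity.HubbardSuperconductivity.Theorems.SWaveCascade

end
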